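import Summits.AtomisticToContinuum.Crystallization.Theorems.FreeSplittingCertificatesRadiusLadderDelsarte
import Summits.AtomisticToContinuum.Crystallization.Theorems.FreeSplittingCertificatesRadiusLadderShellCount
import Summits.AtomisticToContinuum.Crystallization.Theorems.FreeSplittingCertificatesRadiusLadderHalfRule54Table
import Summits.AtomisticToContinuum.Crystallization.Theorems.FreeSplittingCertificatesRadiusLadderStar902

/-!
# `FiniteRangeSplitting` (stmt-AtomisticToContinuum-12559): the half rule is feasible from hard core `5/4` on

Support file for crux r2 of route `FreeSplittingCertificates` (block-2b unit `b2b-freesplit-A`, gen 13).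
VALUE = a theorem deciding instances of the crux (the bracket of the sharp threshold `δ_½` shrinks from
`[47/50, 4/3]` to `[47/50, 5/4]`) — NOT summit progress.

`…RadiusLadderHalfRule` certified `RungAt δ R` for all `δ ≥ 4/3` by a LAYER CAKE whose shell counts came from volume
packing, `#{j : r_ij < t} ≤ (2t/δ + 1)³ − 1` — `26` at contact, where the kissing number is `12`.  Here the same
layer cake is run at hard core `δ = 5/4` on the grid `t_k = 5/4 + k/20` (`k ≤ 75`, `t_75 = 5 = 4δ`), with the count
of the THIN shells `t_{k+1} ≤ 1.70` (`k ≤ 8`) taken instead from DELSARTE'S LINEAR-PROGRAMMING BOUND at degree `5`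
(`…RadiusLadderDelsarte`, `…RadiusLadderShellCount`: in a shell `[δ, t]` with `t(t − δ) ≤ δ²` the directions of
`δ`-separated points have pairwise cosine `≤ 1 − δ²/(2t²)`, and unit vectors with that angular separation number at
most `14, 15, 17, 19, 21, 25, 29, 36, 46`), and from volume packing beyond.  With the tabulated values
`v_k = ⌊10⁶ V(t_k)⌋/10⁶` and the tree's far tail `Σ_{r ≥ 4δ} r⁻⁶ ≤ (1331/512) δ⁻⁶` (`sum_inv_pow_six_far_le`) the
resulting rational inequality `Σ_k (v_k − v_{k+1}) m_k − (1331/512)(5/4)⁻⁶/6 ≥ −1.435` holds with margin `0.118`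
(`gridQ54_ge`, `decide +kernel`; value `≈ −1.31689`), so at every site of every `5/4`-separated configuration the half
pair-sum is `≥ −0.7175 ≥ e_∞` (`halfSum_ge_of_sep54`, `eInf_le_ref`):

* `halfSumFeasible_five_fourths`, `feasible_halfRule_five_fourths`, `rungAt_five_fourths`,
  `rungAt_of_five_fourths_le`, `exists_rung_of_five_fourths_le` — the crux's `δ`-instances are THEOREMS for
  `δ ≥ 5/4` (witness: the half rule, any radius);
* `halfSumThreshold_le_five_fourths`, `halfSumThreshold_mem_Icc_47_50_5_4` — the sharp threshold of
  `…RadiusLadderThreshold` now satisfies `47/50 ≤ δ_½ ≤ 5/4`;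
* `rungAt_lt_sep_decided54` — for `0 < R < δ`: `RungAt δ R` holds if `δ ≥ 5/4`, fails if `δ ≤ 47/50`.

Reach of the method (recorded, not formalised): with Delsarte polynomials of degree `≤ 5`, the first-shell angle
lemma and the crude far tail, the layer cake certifies hard cores down to `≈ 1.22`; `6/5` would need degree `≥ 6–8`
AND a sharper far-tail lemma.  The true `δ_½` is presumably close to `1`.
-/

noncomputable section

namespace Summit.AtomisticToContinuum.Crystallization.Theorems.StrictSplittingRuleBirth

open scoped BigOperators Classical
open Literature.MathematicalPhysics.StatisticalMechanics

/-! ## The grid over `ℝ`: casts and elementary facts -/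

/-- The rational and real grids agree. -/
theorem tk54_cast (k : ℕ) : ((tq54 k : ℚ) : ℝ) = tk54 k := by
  simp only [tq54, tk54]
  push_cast
  ring

/-- The rational and real envelope counts agree. -/
theorem mk54_cast (k : ℕ) : ((mq54 k : ℚ) : ℝ) = mk54 k := by
  simp only [mq54, mk54]
  split_ifs
  · push_cast
    rfl
  · simp only [← tk54_cast]
    push_cast
    ring

/-- The grid is monotone. -/
theorem tk54_mono : Monotone tk54 := fun a b hab => by
  simp only [tk54]
  have : (a : ℝ) ≤ b := by exact_mod_cast hab
  linarith

/-- The grid starts at `5/4`. -/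
theorem five_fourths_le_tk54 (k : ℕ) : 5 / 4 ≤ tk54 k := by
  simp only [tk54]
  have : (0 : ℝ) ≤ (k : ℝ) / 20 := by positivity
  linarith

/-- The last grid point `t_75 = 5 = 4·(5/4)`. -/
theorem tk54_last : tk54 75 = 4 * (5 / 4) := by norm_num [tk54]

/-- Beyond the table the value is `0`. -/
theorem vk54_last : vk54 75 = 0 := by
  have : vq54 75 = 0 := rfl
  simp [vk54, this]

/-- The rational and real potentials agree on the grid. -/
theorem ljQ_cast (k : ℕ) : ((ljQ (tq54 k) : ℚ) : ℝ) = lennardJones (tk54 k) := by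
  simp only [ljQ, lennardJones, ← tk54_cast]
  push_cast
  ring

/-- The table under-estimates `V` on the grid (cast from `vq54_le_ljQ`). -/
theorem vk54_le_lennardJones (k : ℕ) (hk : k < 75) : vk54 k ≤ lennardJones (tk54 k) := by
  have h := (Rat.cast_le (K := ℝ)).2 (vq54_le_ljQ k hk)
  rwa [ljQ_cast] at h

/-- The layer weights are nonpositive (the table is nondecreasing). -/
theorem wk54_nonpos {k : ℕ} (hk : k < 75) : wk54 k ≤ 0 := by
  have h := (Rat.cast_le (K := ℝ)).2 (vq54_le_succ k hk)
  simp only [wk54, vk54]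
  linarith

/-- The grid constant over `ℝ`: `Σ_k w_k m_k − (1331/512)(5/4)⁻⁶/6 ≥ −1.435`. -/
theorem grid54_sum_ge :
    -(1435 / 1000 : ℝ) ≤
      ∑ k ∈ Finset.range 75, wk54 k * mk54 k - (1 / 6) * (1331 / 512 * (5 / 4 : ℝ)⁻¹ ^ 6) := by
  have h := (Rat.cast_le (K := ℝ)).2 gridQ54_ge
  have e : ((gridQ54 : ℚ) : ℝ) =
      ∑ k ∈ Finset.range 75, wk54 k * mk54 k - (1 / 6) * (1331 / 512 * (5 / 4 : ℝ)⁻¹ ^ 6) := by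
    simp only [gridQ54, wk54, vk54, ← mk54_cast]
    push_cast
    rfl
  have e' : ((-(1435 / 1000 : ℚ) : ℚ) : ℝ) = -(1435 / 1000 : ℝ) := by push_cast; rfl
  linarith [h, e, e']

/-! ## The layer-cake majorant at hard core `5/4` -/

/-- **Pointwise majorant**: for `r ≥ 5/4`, `V(r) ≥ layer54 r + tailTerm54 r`. -/
theorem layer54_add_tail_le {r : ℝ} (hr : 5 / 4 ≤ r) : layer54 r + tailTerm54 r ≤ lennardJones r := by
  by_cases hfar : tk54 75 ≤ r
  · -- far: every indicator vanishes, the tail term is the attractive part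
    have h0 : layer54 r = 0 := by
      refine Finset.sum_eq_zero fun k hk => ?_
      have hk : k + 1 ≤ 75 := Finset.mem_range.1 hk
      have : ¬ r < tk54 (k + 1) := not_lt.2 ((tk54_mono hk).trans hfar)
      simp [this]
    rw [h0, zero_add, tailTerm54, if_pos hfar]
    have hr0 : 0 < r := by linarith
    exact neg_le_lennardJones_of_le hr0 le_rfl
  · -- near: `t_{k₀} ≤ r < t_{k₀+1}` with `k₀ < 75`
    rw [not_le] at hfar
    have hr0 : 0 ≤ (r - 5 / 4) * 20 := by linarith
    set k₀ : ℕ := ⌊(r - 5 / 4) * 20⌋₊ with hk₀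
    have h1 : tk54 k₀ ≤ r := by
      have := Nat.floor_le hr0
      simp only [tk54]; linarith
    have h2 : r < tk54 (k₀ + 1) := by
      have := Nat.lt_floor_add_one ((r - 5 / 4) * 20)
      simp only [tk54]; push_cast; linarith
    have hk75 : k₀ < 75 := by
      by_contra h
      rw [not_lt] at h
      have : tk54 75 ≤ tk54 k₀ := tk54_mono h
      linarith
    have hind : ∀ k, (r < tk54 (k + 1) ↔ k₀ ≤ k) := fun k => by
      constructor
      · intro h
        by_contra hlt
        rw [not_le] at hlt
        have : tk54 (k + 1) ≤ tk54 k₀ := tk54_mono (by omega)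
        linarith
      · intro h
        have : tk54 (k₀ + 1) ≤ tk54 (k + 1) := tk54_mono (by omega)
        linarith
    have hsum : layer54 r = vk54 k₀ - vk54 75 := by
      rw [← sum_ite_sub_eq vk54 k₀ 75 hk75.le]
      refine Finset.sum_congr rfl fun k _ => ?_
      by_cases h : k₀ ≤ k
      · rw [if_pos ((hind k).2 h), if_pos h, wk54, mul_one]
      · have : ¬ r < tk54 (k + 1) := fun h' => h ((hind k).1 h')
        rw [if_neg this, if_neg h, mul_zero]
    rw [hsum, vk54_last, sub_zero, tailTerm54, if_neg (not_le.2 hfar), add_zero]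
    exact (vk54_le_lennardJones k₀ hk75).trans
      (Literature.Barriers.AtomisticToContinuum.strictMonoOn_lennardJones.monotoneOn
        (Set.mem_Ici.2 (le_trans (by norm_num) (five_fourths_le_tk54 k₀)))
        (Set.mem_Ici.2 (le_trans (by norm_num) hr)) h1)

/-! ## Shell counts under the envelope -/

/-- Shell `k = 0`: at most `14` neighbours at distance `< t_1 = 1.30` (angular count). -/
theorem angCount54_0 {N : ℕ} {x : Fin N → EuclideanSpace ℝ (Fin 3)} (hx : Sep (5 / 4) x) (i : Fin N) :
    ((((Finset.univ.erase i).filter fun j => dist (x i) (x j) < tk54 (0 + 1)).card : ℕ) : ℝ) ≤ ((angD54 0 : ℕ) : ℝ) :=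
  card_near_le_of_angular' (δ := 5 / 4) (t := tk54 (0 + 1)) (by norm_num) (by norm_num [tk54]) (angD54 0)
    (fun s u hu h => (card_le_14_of_inner_le s u hu fun j hj j' hj' hne =>
      (h j hj j' hj' hne).trans (by norm_num [tk54]) : s.card ≤ 14)) hx i

/-- Shell `k = 1`: at most `15` neighbours at distance `< t_2 = 1.35` (angular count). -/
theorem angCount54_1 {N : ℕ} {x : Fin N → EuclideanSpace ℝ (Fin 3)} (hx : Sep (5 / 4) x) (i : Fin N) :
    ((((Finset.univ.erase i).filter fun j => dist (x i) (x j) < tk54 (1 + 1)).card : ℕ) : ℝ) ≤ ((angD54 1 : ℕ) : ℝ) :=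
  card_near_le_of_angular' (δ := 5 / 4) (t := tk54 (1 + 1)) (by norm_num) (by norm_num [tk54]) (angD54 1)
    (fun s u hu h => (card_le_15_of_inner_le s u hu fun j hj j' hj' hne =>
      (h j hj j' hj' hne).trans (by norm_num [tk54]) : s.card ≤ 15)) hx i

/-- Shell `k = 2`: at most `17` neighbours at distance `< t_3 = 1.40` (angular count). -/
theorem angCount54_2 {N : ℕ} {x : Fin N → EuclideanSpace ℝ (Fin 3)} (hx : Sep (5 / 4) x) (i : Fin N) :
    ((((Finset.univ.erase i).filter fun j => dist (x i) (x j) < tk54 (2 + 1)).card : ℕ) : ℝ) ≤ ((angD54 2 : ℕ) : ℝ) :=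
  card_near_le_of_angular' (δ := 5 / 4) (t := tk54 (2 + 1)) (by norm_num) (by norm_num [tk54]) (angD54 2)
    (fun s u hu h => (card_le_17_of_inner_le s u hu fun j hj j' hj' hne =>
      (h j hj j' hj' hne).trans (by norm_num [tk54]) : s.card ≤ 17)) hx i

/-- Shell `k = 3`: at most `19` neighbours at distance `< t_4 = 1.45` (angular count). -/
theorem angCount54_3 {N : ℕ} {x : Fin N → EuclideanSpace ℝ (Fin 3)} (hx : Sep (5 / 4) x) (i : Fin N) :
    ((((Finset.univ.erase i).filter fun j => dist (x i) (x j) < tk54 (3 + 1)).card : ℕ) : ℝ) ≤ ((angD54 3 : ℕ) : ℝ) :=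
  card_near_le_of_angular' (δ := 5 / 4) (t := tk54 (3 + 1)) (by norm_num) (by norm_num [tk54]) (angD54 3)
    (fun s u hu h => (card_le_19_of_inner_le s u hu fun j hj j' hj' hne =>
      (h j hj j' hj' hne).trans (by norm_num [tk54]) : s.card ≤ 19)) hx i

/-- Shell `k = 4`: at most `21` neighbours at distance `< t_5 = 1.50` (angular count). -/
theorem angCount54_4 {N : ℕ} {x : Fin N → EuclideanSpace ℝ (Fin 3)} (hx : Sep (5 / 4) x) (i : Fin N) :
    ((((Finset.univ.erase i).filter fun j => dist (x i) (x j) < tk54 (4 + 1)).card : ℕ) : ℝ) ≤ ((angD54 4 : ℕ) : ℝ) :=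
  card_near_le_of_angular' (δ := 5 / 4) (t := tk54 (4 + 1)) (by norm_num) (by norm_num [tk54]) (angD54 4)
    (fun s u hu h => (card_le_21_of_inner_le s u hu fun j hj j' hj' hne =>
      (h j hj j' hj' hne).trans (by norm_num [tk54]) : s.card ≤ 21)) hx i

/-- Shell `k = 5`: at most `25` neighbours at distance `< t_6 = 1.55` (angular count). -/
theorem angCount54_5 {N : ℕ} {x : Fin N → EuclideanSpace ℝ (Fin 3)} (hx : Sep (5 / 4) x) (i : Fin N) :
    ((((Finset.univ.erase i).filter fun j => dist (x i) (x j) < tk54 (5 + 1)).card : ℕ) : ℝ) ≤ ((angD54 5 : ℕ) : ℝ) :=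
  card_near_le_of_angular' (δ := 5 / 4) (t := tk54 (5 + 1)) (by norm_num) (by norm_num [tk54]) (angD54 5)
    (fun s u hu h => (card_le_25_of_inner_le s u hu fun j hj j' hj' hne =>
      (h j hj j' hj' hne).trans (by norm_num [tk54]) : s.card ≤ 25)) hx i

/-- Shell `k = 6`: at most `29` neighbours at distance `< t_7 = 1.60` (angular count). -/
theorem angCount54_6 {N : ℕ} {x : Fin N → EuclideanSpace ℝ (Fin 3)} (hx : Sep (5 / 4) x) (i : Fin N) :
    ((((Finset.univ.erase i).filter fun j => dist (x i) (x j) < tk54 (6 + 1)).card : ℕ) : ℝ) ≤ ((angD54 6 : ℕ) : ℝ) :=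
  card_near_le_of_angular' (δ := 5 / 4) (t := tk54 (6 + 1)) (by norm_num) (by norm_num [tk54]) (angD54 6)
    (fun s u hu h => (card_le_29_of_inner_le s u hu fun j hj j' hj' hne =>
      (h j hj j' hj' hne).trans (by norm_num [tk54]) : s.card ≤ 29)) hx i

/-- Shell `k = 7`: at most `36` neighbours at distance `< t_8 = 1.65` (angular count). -/
theorem angCount54_7 {N : ℕ} {x : Fin N → EuclideanSpace ℝ (Fin 3)} (hx : Sep (5 / 4) x) (i : Fin N) :
    ((((Finset.univ.erase i).filter fun j => dist (x i) (x j) < tk54 (7 + 1)).card : ℕ) : ℝ) ≤ ((angD54 7 : ℕ) : ℝ) :=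
  card_near_le_of_angular' (δ := 5 / 4) (t := tk54 (7 + 1)) (by norm_num) (by norm_num [tk54]) (angD54 7)
    (fun s u hu h => (card_le_36_of_inner_le s u hu fun j hj j' hj' hne =>
      (h j hj j' hj' hne).trans (by norm_num [tk54]) : s.card ≤ 36)) hx i

/-- Shell `k = 8`: at most `46` neighbours at distance `< t_9 = 1.70` (angular count). -/
theorem angCount54_8 {N : ℕ} {x : Fin N → EuclideanSpace ℝ (Fin 3)} (hx : Sep (5 / 4) x) (i : Fin N) :
    ((((Finset.univ.erase i).filter fun j => dist (x i) (x j) < tk54 (8 + 1)).card : ℕ) : ℝ) ≤ ((angD54 8 : ℕ) : ℝ) :=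
  card_near_le_of_angular' (δ := 5 / 4) (t := tk54 (8 + 1)) (by norm_num) (by norm_num [tk54]) (angD54 8)
    (fun s u hu h => (card_le_46_of_inner_le s u hu fun j hj j' hj' hne =>
      (h j hj j' hj' hne).trans (by norm_num [tk54]) : s.card ≤ 46)) hx i

/-- Every shell count is under the envelope `m_k`. -/
theorem count_le_mk54 {N : ℕ} {x : Fin N → EuclideanSpace ℝ (Fin 3)} (hx : Sep (5 / 4) x) (i : Fin N) (k : ℕ)
    (hk : k < 75) :
    ((((Finset.univ.erase i).filter fun j => dist (x i) (x j) < tk54 (k + 1)).card : ℕ) : ℝ) ≤ mk54 k := by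
  by_cases h9 : k < 9
  · rw [mk54, if_pos h9]
    interval_cases k
    · exact angCount54_0 hx i
    · exact angCount54_1 hx i
    · exact angCount54_2 hx i
    · exact angCount54_3 hx i
    · exact angCount54_4 hx i
    · exact angCount54_5 hx i
    · exact angCount54_6 hx i
    · exact angCount54_7 hx i
    · exact angCount54_8 hx i
  · rw [mk54, if_neg h9]
    exact card_near_le (by norm_num) hx i (le_trans (by norm_num) (five_fourths_le_tk54 (k + 1)))

/-! ## The certified floor of the pair-sum at hard core `5/4` -/

/-- **Certified floor**: at every site of every `5/4`-separated finite configuration the pair-sum is `≥ −1.435`. -/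
theorem sum_lennardJones_ge_of_sep54 {N : ℕ} {x : Fin N → EuclideanSpace ℝ (Fin 3)} (hx : Sep (5 / 4) x)
    (i : Fin N) : -(1435 / 1000 : ℝ) ≤ ∑ j ∈ Finset.univ.erase i, lennardJones (dist (x i) (x j)) := by
  set S := Finset.univ.erase i with hS
  have hδ : (0 : ℝ) < 5 / 4 := by norm_num
  have hdist : ∀ j ∈ S, 5 / 4 ≤ dist (x i) (x j) := fun j hj =>
    hx i j (Finset.ne_of_mem_erase hj).symm
  -- pointwise majorant, summed
  have step1 : ∑ j ∈ S, (layer54 (dist (x i) (x j)) + tailTerm54 (dist (x i) (x j))) ≤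
      ∑ j ∈ S, lennardJones (dist (x i) (x j)) :=
    Finset.sum_le_sum fun j hj => layer54_add_tail_le (hdist j hj)
  -- the layer part: swap sums, bound counts by the envelope (weights are nonpositive)
  have step2 : ∑ k ∈ Finset.range 75, wk54 k * mk54 k ≤ ∑ j ∈ S, layer54 (dist (x i) (x j)) := by
    have hswap : ∑ j ∈ S, layer54 (dist (x i) (x j)) =
        ∑ k ∈ Finset.range 75, wk54 k * ∑ j ∈ S, (if dist (x i) (x j) < tk54 (k + 1) then (1 : ℝ) else 0) := by
      simp only [layer54, Finset.mul_sum]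
      exact Finset.sum_comm
    rw [hswap]
    refine Finset.sum_le_sum fun k hk => ?_
    have hcount : ∑ j ∈ S, (if dist (x i) (x j) < tk54 (k + 1) then (1 : ℝ) else 0) ≤ mk54 k := by
      rw [Finset.sum_boole]
      exact count_le_mk54 hx i k (Finset.mem_range.1 hk)
    exact mul_le_mul_of_nonpos_left hcount (wk54_nonpos (Finset.mem_range.1 hk))
  -- the tail part
  have step3 : -((1 / 6) * (1331 / 512 * (5 / 4 : ℝ)⁻¹ ^ 6)) ≤ ∑ j ∈ S, tailTerm54 (dist (x i) (x j)) := by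
    have hsplit : ∑ j ∈ S, tailTerm54 (dist (x i) (x j)) =
        ∑ j ∈ S.filter (fun j => tk54 75 ≤ dist (x i) (x j)), -((1 / 6) * (dist (x i) (x j))⁻¹ ^ 6) := by
      rw [Finset.sum_filter]
      rfl
    have htail := sum_inv_pow_six_far_le x hδ hx i
    rw [← tk54_last] at htail
    rw [hsplit, Finset.sum_neg_distrib, ← Finset.mul_sum, neg_le_neg_iff]
    exact mul_le_mul_of_nonneg_left htail (by norm_num)
  have := grid54_sum_ge
  rw [Finset.sum_add_distrib] at step1
  linarith

/-- **The half pair-sum never drops below `−0.7175` at hard core `5/4`.** -/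
theorem halfSum_ge_of_sep54 {N : ℕ} {x : Fin N → EuclideanSpace ℝ (Fin 3)} (hx : Sep (5 / 4) x) (i : Fin N) :
    -(7175 / 10000 : ℝ) ≤ (∑ j ∈ Finset.univ.erase i, lennardJones (dist (x i) (x j))) / 2 := by
  have := sum_lennardJones_ge_of_sep54 hx i
  linarith

/-! ## The rungs and the threshold bracket -/

/-- **The deepest-site inequality holds at hard core `5/4`.** -/
theorem halfSumFeasible_five_fourths : HalfSumFeasible (5 / 4) := fun _ _ hx i =>
  eInf_le_ref.trans (halfSum_ge_of_sep54 hx i)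

/-- … and at every larger hard core. -/
theorem halfSumFeasible_of_five_fourths_le {δ : ℝ} (h : 5 / 4 ≤ δ) : HalfSumFeasible δ :=
  halfSumFeasible_mono h halfSumFeasible_five_fourths

/-- **The half rule is feasible at hard core `5/4`, at every radius.** -/
theorem feasible_halfRule_five_fourths (R : ℝ) : Feasible (5 / 4) R halfRule :=
  (feasible_halfRule_iff (5 / 4) R).2 halfSumFeasible_five_fourths

/-- **`RungAt (5/4) R` for every `R`.** -/
theorem rungAt_five_fourths (R : ℝ) : RungAt (5 / 4) R :=
  rungAt_of_halfSumFeasible halfSumFeasible_five_fourths R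

/-- **The hard-core end of the `δ`-ladder, lowered**: every `δ ≥ 5/4` has every rung. -/
theorem rungAt_of_five_fourths_le {δ : ℝ} (hδ : 5 / 4 ≤ δ) (R : ℝ) : RungAt δ R :=
  rungAt_of_halfSumFeasible (halfSumFeasible_of_five_fourths_le hδ) R

/-- Read back on crux r2: its `δ`-instances for `δ ≥ 5/4` are theorems (witness: any `R > 0`, the half rule). -/
theorem exists_rung_of_five_fourths_le : ∀ δ : ℝ, 5 / 4 ≤ δ → ∃ R : ℝ, 0 < R ∧ RungAt δ R :=
  fun _ hδ => ⟨1, one_pos, rungAt_of_five_fourths_le hδ 1⟩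

/-- `δ_½ ≤ 5/4` for the sharp threshold `halfSumThreshold` of `…RadiusLadderThreshold`. -/
theorem halfSumThreshold_le_five_fourths : halfSumThreshold ≤ 5 / 4 :=
  halfSumThreshold_le_of halfSumFeasible_five_fourths

/-- **The bracket**: `47/50 ≤ δ_½ ≤ 5/4` (`Star902`; the Delsarte layer cake). -/
theorem halfSumThreshold_mem_Icc_47_50_5_4 : halfSumThreshold ∈ Set.Icc ((47 : ℝ) / 50) (5 / 4) :=
  ⟨le_halfSumThreshold_47_50, halfSumThreshold_le_five_fourths⟩

/-- **The small-radius rungs, decided outside `(47/50, 5/4)`**: for `0 < R < δ`, `RungAt δ R` holds if `δ ≥ 5/4`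
and fails if `δ ≤ 47/50`; in between it is the single open inequality `HalfSumFeasible δ`. -/
theorem rungAt_lt_sep_decided54 {δ R : ℝ} (hδ : 0 < δ) (hR : R < δ) :
    (5 / 4 ≤ δ → RungAt δ R) ∧ (δ ≤ 47 / 50 → ¬ RungAt δ R) ∧ (RungAt δ R ↔ HalfSumFeasible δ) :=
  ⟨fun h => rungAt_of_five_fourths_le h R,
    fun h hr => not_halfSumFeasible_of_le_47_50 h (halfSumFeasible_of_rungAt hδ hR hr),
    rungAt_iff_halfSumFeasible_of_lt hδ hR⟩

end Summit.AtomisticToContinuum.Crystallization.Theorems.StrictSplittingRuleBirth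

end
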